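import Summits.BirchSwinnertonDyer.BirchSwinnertonDyer.Theorems.ManinLocalTwoThreeUFamilyConductorAtTwo
import Summits.BirchSwinnertonDyer.BirchSwinnertonDyer.Theorems.ManinLocalTwoThreeCDivisionIntegralCDT
import Summits.BirchSwinnertonDyer.Rank1Residual.ManinAdditive.KummerDiamondLocalTwoAdic
import Literature.NumberTheory.DiophantineGeometry.TateAlgorithmIstarCharTwoProofs
import HarnessLib

/-!
# E-es-186♭ `FreyTwistShapeConductorExponentTwoLaw` IS A THEOREM: a curve `y² = x(x − 2s²)(x − t²)` (`s` even, `t` odd) has `f₂ = 4`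
# — Tate's algorithm "family C" in residue characteristic `2`; hence E-es-186, and C2 `ManinOddAtFour` ⟸ CDT Theorem 1 ∧ E-es-185
(route `ManinLocalTwoThree`, crux C2 `ManinOddAtFour` stmt-BirchSwinnertonDyer-22967; cell bsd-f2-manin, prover p2 gen 21; TURNKEY P-es-g38-1 of
es g38 MEMO-es §59.13(c)(d); `--supports stmt-BirchSwinnertonDyer-22967`)

es g38's EXCLUSION THEOREM (MEMO-es §59.5, ref1 §R215 SOUND) kills the index-`4` world `Λ₁(f) = 2Λ₀(f)` — the whole residual of C2 modulo CDT —
from two rows: E-es-185 `IndexFourForcesFreyTwistShape` (index `4` ⟹ `2⁵ ∣ N` and the curve is `ℚ`-isomorphic to `y² = x(x − 2s²)(x − t²)`, `s` even,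
`t` odd; Kummer–diamond reciprocity, OPEN in Lean) and E-es-186 `FreyTwistShapeTwoAdicLaw` (such a curve has no datum at a level divisible by `2⁵`),
the latter reduced by es's PROVED glue `freyTwistShapeTwoAdicLaw_of_local` to the LOCAL row E-es-186♭ `FreyTwistShapeConductorExponentTwoLaw`
(`HasFreyTwistShape W → (N_W).factorization 2 = 4`) plus modularity.  THIS FILE PROVES E-es-186♭:

* §1 **family C** of the `Iₙ*` sub-procedure in residue characteristic `2` (any DVR `R` with perfect residue field and `2 = ϖε`): `ϖ ∣ a₁`,
  `a₂ = ϖβ`, `a₃ = 0`, `a₄ = ϖ^{m+3}δ`, `a₆ = 0` (`β, δ` units) ⟹ rounds `0, …, m−1` pass on the same model (`istarIndexAux_add_of_dvd`), in round `m`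
  the first quadratic is `Y²` and the second is `β̄X² + δ̄X` with distinct roots: `istarIndexAux` returns `2m + 2`, type **`I*_{2m+2}`**
  (`kodairaSymbolOfMinimal_familyC`; no translation at all — simpler than the tree's families A/B of `…TateAlgorithmIstarCharTwoProofs`);
* §2 the `ℤ₂`-exit model of the Frey-twist curve: `(1, 0, 1, 0) • [0, −(2s²+t²), 0, 2s²t², 0] = [2, −(2s²+t²)−1, 0, 2s²t², 0]` is family C with
  `m = 2k'` (`|s| = 2^{k'+1}·odd`), `ord₂Δ = 4k' + 10` (`Δ = 64 s⁴t⁴(2s² − t²)²`), type `I*_{4k'+2}`;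
* §3 Ogg's formula on the exit model (tree `conductorExponent_two_of_exitModel`): `f₂ = (4k'+10) + 1 − (4k'+2+5) = 4`; transport along the `ℚ`-isomorphism
  (`conductorExponent_smul'`) and `factorization_conductorNorm_holds`: **`freyTwistShapeConductorExponentTwoLaw_holds`**, hence
  **`freyTwistShapeTwoAdicLaw_holds_of_modularity : exists_isNewformOf → FreyTwistShapeTwoAdicLaw`** (E-es-186 modulo modularity);
* §4 compositions: E-an-152b ⟸ modularity ∧ E-es-185 (`shimuraIndexNeFourAtFour_of_modularity_shape185`), and **C2 `ManinOddAtFour` ⟸ CDT THEOREM 1 ∧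
  E-es-185** (`maninOddAtFour_of_CDTInt_shape185`; modularity is the crux's own fourth binder), `ManinConstantOne ⟸ PrintedSemistableManinFacts ∧ CDT Thm 1 ∧
  E-es-185`.

HONEST FRAMING.  §1–§3 are unconditional local algebra (Tate's algorithm, kernel-checked); §4 is CONDITIONAL on the printed CDT Theorem 1 and on the OPEN
row E-es-185 (paper theorem per es §59.5 / ref1 §R215; its Lean proof needs the Galois action on the cusps of `X₁(N)`, Stevens 1982 Thm. 1.3.1(b), not in
the tree).  C2, Manin's conjecture and BSD are NOT proved here.  No definitions, no sorry.
[cite: SilvermanATAEC1994, IV.9.4 Steps 1–7 and IV.11.1 (PDF pp. 344–346, 361)] [cite: CalegariDimitrovTang2025, Thm. 1.0.1] [cite: Stevens1989, §2]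
[cite: DiamondKramer1995, (conductor of Frey curves at 2; context)]
-/

set_option autoImplicit false
-- lint-debt: the directory name repeats the summit name (sibling precedent `ManinLocalTwoThreeUFamilyConductorAtTwo.lean`)
set_option linter.dupNamespace false

noncomputable section

open scoped Classical
open Polynomial IsLocalRing WeierstrassCurve
open IsDiscreteValuationRing hiding maximalIdeal
open Literature.NumberTheory.DiophantineGeometry Literature.NumberTheory.DiophantineGeometry.TateAlgorithm
open Literature.NumberTheory.EllipticCurves Literature.NumberTheory.EllipticCurves.ModularForms
open Literature.NumberTheory.Automorphic
open Summit.BirchSwinnertonDyer.Rank1Residual.ManinAdditive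
open Summit.BirchSwinnertonDyer.Rank1Residual.ManinAdditive.KummerDiamond

namespace Summit.BirchSwinnertonDyer.BirchSwinnertonDyer.Theorems.ManinLocalTwoThree.FreyTwistConductor

/-! ## §1 Family C of the `Iₙ*` sub-procedure (residue characteristic `2`, any DVR with perfect residue field) -/

section FamilyC

variable {R : Type*} [CommRing R] [IsDomain R] [IsDiscreteValuationRing R] [PerfectField (ResidueField R)]

/-- **Family C, round-indexed.**  With `2 = ϖε`, `ϖ ∣ a₁`, `a₂ = ϖβ` (`β` a unit), `a₃ = 0`, `a₄ = ϖ^{m+3}δ` (`δ` a unit), `a₆ = 0`, the `Iₙ*`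
sub-procedure returns `n = 2m + 2`: rounds `0, …, m − 1` pass on the same model; in round `m` the first quadratic is `Y²` (double root, the identity
is an admissible `y`-translation) and the second is `β̄X² + δ̄X`, with distinct roots.  Silverman *ATAEC* IV.9.4, Step 7.
[cite: SilvermanATAEC1994, IV.9.4 Step 7 (PDF p. 346)] -/
theorem istarIndexAux_familyC {m : ℕ} (fuel : ℕ) {W : WeierstrassCurve R} {ε β δ : R}
    (hε : (2 : R) = uniformizer R * ε) (h1 : uniformizer R ∣ W.a₁)
    (ha₂ : W.a₂ = uniformizer R * β) (hβ : IsUnit β) (ha₃ : W.a₃ = 0)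
    (ha₄ : W.a₄ = uniformizer R ^ (m + 3) * δ) (hδ : IsUnit δ) (ha₆ : W.a₆ = 0) :
    istarIndexAux (fuel + 1 + m) 0 W = 2 * m + 2 := by
  set ϖ := uniformizer R with hϖdef
  have h20 := residue_two_eq_zero hε
  have h2 : ϖ ∣ W.a₂ := ⟨β, ha₂⟩
  have h2n : ¬ ϖ ^ 2 ∣ W.a₂ := by rw [ha₂]; exact not_sq_dvd_uniformizer_mul hβ
  have h3 : ∀ n, ϖ ^ n ∣ W.a₃ := fun n => by rw [ha₃]; exact dvd_zero _
  have h6 : ∀ n, ϖ ^ n ∣ W.a₆ := fun n => by rw [ha₆]; exact dvd_zero _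
  have h4 : ϖ ^ (m + 3) ∣ W.a₄ := ⟨δ, ha₄⟩
  -- rounds `0, …, m - 1`
  rw [istarIndexAux_add_of_dvd (M := m) h1 h2 h2n (h3 _) h4 (h6 _) m 0 (fuel + 1) (zero_add m)]
  -- round `m`: the first test fails, the second fires on the model itself
  have hA : distinctRootCount
      (X ^ 2 + C (redCoeff W.a₃ (m + 2)) * X - C (redCoeff W.a₆ (2 * m + 4))) ≠ 2 := by
    rw [Ne, testA_iff_of_two_eq_zero h20, not_not, redCoeff_eq_zero_of_dvd (h3 _)]
  have ha2 : redCoeff W.a₂ 1 ≠ 0 := by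
    rw [ha₂, redCoeff_uniformizer_mul]; exact (isUnit_iff_residue_ne_zero β).mp hβ
  have hb : redCoeff W.a₄ (m + 3) ≠ 0 := by
    rw [ha₄, redCoeff_uniformizer_pow_mul]; exact (isUnit_iff_residue_ne_zero δ).mp hδ
  have hB : distinctRootCount (C (redCoeff W.a₂ 1) * X ^ 2 + C (redCoeff W.a₄ (m + 3)) * X
      + C (redCoeff W.a₆ (2 * m + 5))) = 2 := (testB_iff_of_two_eq_zero h20 ha2 _ _).mpr hb
  exact istarIndexAux_succ_of_testB (C₁ := 1) h1 h2 h2n (h3 _) h4 (h6 _) hA (one_smul _ W).symm h1 h2 h2n (h3 _)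
    h4 (h6 _) hB

/-- **Family C** (es's indexing): `2 = ϖε`, `ϖ ∣ a₁`, `a₂ = ϖβ`, `a₃ = 0`, `a₄ = ϖᴹδ`, `a₆ = 0` (`β, δ` units), `M ≥ 3`: with any fuel `≥ M − 2` the
`Iₙ*` sub-procedure returns `n = 2M − 4`. [cite: SilvermanATAEC1994, IV.9.4 Step 7 (PDF p. 346)] -/
theorem istarIndexAux_familyC' {M fuel : ℕ} (hM : 3 ≤ M) (hfuel : M - 2 ≤ fuel) {W : WeierstrassCurve R} {ε β δ : R}
    (hε : (2 : R) = uniformizer R * ε) (h1 : uniformizer R ∣ W.a₁)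
    (ha₂ : W.a₂ = uniformizer R * β) (hβ : IsUnit β) (ha₃ : W.a₃ = 0)
    (ha₄ : W.a₄ = uniformizer R ^ M * δ) (hδ : IsUnit δ) (ha₆ : W.a₆ = 0) :
    istarIndexAux fuel 0 W = 2 * M - 4 := by
  obtain ⟨m, rfl⟩ : ∃ m, M = m + 3 := ⟨M - 3, by omega⟩
  obtain ⟨f, rfl⟩ : ∃ f, fuel = f + 1 + m := ⟨fuel - 1 - m, by omega⟩
  rw [istarIndexAux_familyC f hε h1 ha₂ hβ ha₃ ha₄ hδ ha₆]; omega

/-- **Kodaira type of family C: `Iₙ*` with `n = 2M − 4`** (`M ≥ 3`, `ord Δ ≥ M − 2`; over `ℤ₂` these are the Frey-twist curves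
`y² = x(x − 2s²)(x − t²)`, `s` even, `t` odd, after `y ↦ y + x`, with `M = 2v₂(s) + 1`).  Silverman *ATAEC* IV.9.4.
[cite: SilvermanATAEC1994, IV.9.4 (PDF pp. 344–346)] -/
theorem kodairaSymbolOfMinimal_familyC {M : ℕ} (hM : 3 ≤ M) {W : WeierstrassCurve R}
    (hΔ : M - 2 ≤ (addVal R W.Δ).toNat) {ε β δ : R} (hε : (2 : R) = uniformizer R * ε)
    (h1 : uniformizer R ∣ W.a₁) (ha₂ : W.a₂ = uniformizer R * β) (hβ : IsUnit β) (ha₃ : W.a₃ = 0)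
    (ha₄ : W.a₄ = uniformizer R ^ M * δ) (hδ : IsUnit δ) (ha₆ : W.a₆ = 0) :
    W.kodairaSymbolOfMinimal = .Istar (2 * M - 4) := by
  set ϖ := uniformizer R with hϖdef
  have hΔ' : ϖ ∣ W.Δ := by
    have hle : ((1 : ℕ) : ℕ∞) ≤ addVal R W.Δ := by
      have h1N : (1 : ℕ) ≤ (addVal R W.Δ).toNat := le_trans (by omega) hΔ
      by_cases htop : addVal R W.Δ = ⊤
      · rw [htop]; exact le_top
      · rw [← ENat.coe_toNat htop]; exact_mod_cast h1N
    simpa using (pow_dvd_iff_le_addVal (a := W.Δ) (n := 1)).mpr hle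
  rw [kodairaSymbolOfMinimal_eq_Istar_istarIndexAux_self hε h1 ha₂ hβ ha₃
    ((pow_dvd_pow ϖ hM).trans ⟨δ, ha₄⟩) (by rw [ha₆]; exact dvd_zero _) hΔ',
    istarIndexAux_familyC' hM hΔ hε h1 ha₂ hβ ha₃ ha₄ hδ ha₆]

end FamilyC

/-! ## §2 The `ℤ₂`-exit model of the Frey-twist curve `y² = x(x − 2s²)(x − t²)` -/

/-- **The exit model of the Frey-twist curve is family C** and has `ord₂Δ = 4k' + 10`, type `I*_{4k'+2}`: for `s = 2^{k'+1}·(odd)` up to sign and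
`t` odd, `T′ := (1, 0, 1, 0) • [0, −(2s²+t²), 0, 2s²t², 0]` over `ℤ₂` has `T′.kodairaSymbolOfMinimal = I*_{4k'+2}` and `ord₂ Δ(T′) = 4k' + 10`.
[cite: SilvermanATAEC1994, IV.9.4 (PDF pp. 344–346)] -/
theorem freyTwist_exitModel (k' : ℕ) {s t : ℤ} {m₀ : ℕ} (hm₀ : Odd m₀) (hs : s.natAbs = 2 ^ (k' + 1) * m₀) (ht : Odd t) :
    (((⟨1, 0, 1, 0⟩ : VariableChange ℤ_[2]) •
        (⟨0, -(2 * (s : ℤ_[2]) ^ 2 + (t : ℤ_[2]) ^ 2), 0, 2 * (s : ℤ_[2]) ^ 2 * (t : ℤ_[2]) ^ 2, 0⟩ : WeierstrassCurve ℤ_[2])).kodairaSymbolOfMinimal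
        = .Istar (4 * k' + 2)) ∧
      (addVal ℤ_[2] ((⟨1, 0, 1, 0⟩ : VariableChange ℤ_[2]) •
        (⟨0, -(2 * (s : ℤ_[2]) ^ 2 + (t : ℤ_[2]) ^ 2), 0, 2 * (s : ℤ_[2]) ^ 2 * (t : ℤ_[2]) ^ 2, 0⟩ : WeierstrassCurve ℤ_[2])).Δ).toNat
        = 4 * k' + 10 := by
  haveI : Fact (Nat.Prime 2) := ⟨Nat.prime_two⟩
  obtain ⟨ε, hεu, hε⟩ := TwistGoodTwo.exists_isUnit_two_eq_uniformizer_mul_padicInt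
  set ϖ : ℤ_[2] := uniformizer ℤ_[2] with hϖ
  have hirr : Irreducible ϖ := irreducible_uniformizer
  set σ : ℤ_[2] := (s : ℤ_[2]) with hσdef
  set τ : ℤ_[2] := (t : ℤ_[2]) with hτdef
  set μ : ℤ_[2] := ((m₀ : ℤ) : ℤ_[2]) with hμdef
  set E : WeierstrassCurve ℤ_[2] := ⟨0, -(2 * σ ^ 2 + τ ^ 2), 0, 2 * σ ^ 2 * τ ^ 2, 0⟩ with hE
  set T' : WeierstrassCurve ℤ_[2] := (⟨1, 0, 1, 0⟩ : VariableChange ℤ_[2]) • E with hT'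
  have hu : (⟨1, 0, 1, 0⟩ : VariableChange ℤ_[2]).u = 1 := rfl
  -- `σ² = 2^{2k'+2} μ²`, `τ = 1 + 2j`, `μ = 1 + 2j'`
  obtain ⟨j, hj⟩ := ht
  obtain ⟨j', hj'⟩ := hm₀
  have hσ : σ ^ 2 = (2 : ℤ_[2]) ^ (2 * k' + 2) * μ ^ 2 := by
    have h1 : (s : ℤ) ^ 2 = ((s.natAbs : ℤ)) ^ 2 := (Int.natAbs_sq s).symm
    have h2 : ((s : ℤ) : ℤ_[2]) ^ 2 = (((s.natAbs : ℤ) : ℤ_[2])) ^ 2 := by exact_mod_cast congrArg (fun z : ℤ ↦ (z : ℤ_[2])) h1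
    rw [hσdef, h2, hs, hμdef]; push_cast; ring
  have hτ : τ = 1 + 2 * (j : ℤ_[2]) := by rw [hτdef, hj]; push_cast; ring
  have hμ : μ = 1 + 2 * (j' : ℤ_[2]) := by rw [hμdef, hj']; push_cast; ring
  -- the coefficients of the exit model
  have e1 : T'.a₁ = 2 := by rw [hT', smul_a₁_of_u_eq_one hu]; simp [hE]
  have e2 : T'.a₂ = -(2 * σ ^ 2 + τ ^ 2) - 1 := by rw [hT', smul_a₂_of_u_eq_one hu]; simp [hE]
  have e3 : T'.a₃ = 0 := by rw [hT', smul_a₃_of_u_eq_one hu]; simp [hE]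
  have e4 : T'.a₄ = 2 * σ ^ 2 * τ ^ 2 := by rw [hT', smul_a₄_of_u_eq_one hu]; simp [hE]
  have e6 : T'.a₆ = 0 := by rw [hT', smul_a₆_of_u_eq_one hu]; simp [hE]
  have eΔ : T'.Δ = 64 * σ ^ 4 * τ ^ 4 * (2 * σ ^ 2 - τ ^ 2) ^ 2 := by
    rw [hT', variableChange_Δ, hu]
    simp only [inv_one, Units.val_one, one_pow, one_mul, hE, WeierstrassCurve.Δ, WeierstrassCurve.b₂, WeierstrassCurve.b₄,
      WeierstrassCurve.b₆, WeierstrassCurve.b₈]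
    ring
  -- family C data: `a₁ = ϖε`, `a₂ = ϖβ`, `a₄ = ϖ^{2k'+3} δ`
  set β : ℤ_[2] := -(ε * (1 + ϖ * (ε * ((j : ℤ_[2]) ^ 2 + j + (ϖ * ε) ^ (2 * k' + 1) * μ ^ 2)))) with hβ
  set δ : ℤ_[2] := ε ^ (2 * k' + 3) * μ ^ 2 * τ ^ 2 with hδ
  have hβu : IsUnit β := ((hεu.mul (isUnit_add_mul_of_isUnit hirr isUnit_one _))).neg
  have hμu : IsUnit μ := by rw [hμ]; exact isUnit_one_add_two_mul_padicInt _
  have hτu : IsUnit τ := by rw [hτ]; exact isUnit_one_add_two_mul_padicInt _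
  have hδu : IsUnit δ := ((hεu.pow _).mul (hμu.pow 2)).mul (hτu.pow 2)
  have h1 : ϖ ∣ T'.a₁ := ⟨ε, by rw [e1, hε]⟩
  have ha₂ : T'.a₂ = ϖ * β := by
    have hσ' : σ ^ 2 = (ϖ * ε) ^ (2 * k' + 2) * μ ^ 2 := by rw [hσ, hε]
    have hτ' : τ = 1 + ϖ * ε * (j : ℤ_[2]) := by rw [hτ, hε]
    rw [e2, hσ', hτ', hβ]
    linear_combination (-((ϖ * ε) ^ (2 * k' + 2) * μ ^ 2) - 1 - ϖ * ε * (j : ℤ_[2])) * hε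
  have ha₄ : T'.a₄ = ϖ ^ (2 * k' + 3) * δ := by
    rw [e4, hσ, hδ, hε]; ring
  -- `ord₂ Δ = 4k' + 10`
  set U : ℤ_[2] := ε ^ (4 * k' + 10) * μ ^ 4 * τ ^ 4 * (ϖ * ε * σ ^ 2 - τ ^ 2) ^ 2 with hU
  have hoddu : IsUnit (ϖ * ε * σ ^ 2 - τ ^ 2) := by
    have e : ϖ * ε * σ ^ 2 - τ ^ 2 = -(1 + ϖ * (ε * ((j : ℤ_[2]) + j + ϖ * ε * j ^ 2) - ε * σ ^ 2)) := by
      rw [hτ, hε]; ring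
    rw [e]; exact (isUnit_add_mul_of_isUnit hirr isUnit_one _).neg
  have hUu : IsUnit U := (((hεu.pow _).mul (hμu.pow 4)).mul (hτu.pow 4)).mul (hoddu.pow 2)
  have hord : (addVal ℤ_[2] T'.Δ).toNat = 4 * k' + 10 := by
    refine addVal_toNat_eq_of_eq hirr (c := 1) (u := U) (n := 4 * k' + 10) isUnit_one hUu ?_
    rw [one_mul, eΔ, hU]
    have h64 : (64 : ℤ_[2]) = (ϖ * ε) ^ 6 := by rw [← hε]; norm_num
    have hσ4 : σ ^ 4 = (ϖ * ε) ^ (4 * k' + 4) * μ ^ 4 := by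
      rw [show σ ^ 4 = (σ ^ 2) ^ 2 by ring, hσ, hε]; ring
    have h2' : (2 : ℤ_[2]) * σ ^ 2 = ϖ * ε * σ ^ 2 := by rw [hε]
    rw [h2', h64, hσ4]; ring
  -- family C: type `I*_{2(2k'+3) − 4} = I*_{4k'+2}`
  have hkod := kodairaSymbolOfMinimal_familyC (M := 2 * k' + 3) (by omega) (by rw [hord]; omega) hε h1 ha₂ hβu e3 ha₄ hδu e6
  rw [show 2 * (2 * k' + 3) - 4 = 4 * k' + 2 by omega] at hkod
  exact ⟨hkod, hord⟩

/-! ## §3 E-es-186♭: `f₂ = 4` for every curve of Frey-twist shape -/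

/-- The discriminant of the Frey-twist model: `Δ = 64 s⁴ t⁴ (2s² − t²)²`. [folklore] -/
theorem freyTwistCurve_Δ (s t : ℤ) :
    (freyTwistCurve s t).Δ = 64 * (s : ℚ) ^ 4 * (t : ℚ) ^ 4 * (2 * (s : ℚ) ^ 2 - (t : ℚ) ^ 2) ^ 2 := by
  simp only [freyTwistCurve, WeierstrassCurve.Δ, WeierstrassCurve.b₂, WeierstrassCurve.b₄, WeierstrassCurve.b₆, WeierstrassCurve.b₈]
  push_cast; ring

/-- **`f₂ = 4` for the Frey-twist model** `F = y² = x(x − 2s²)(x − t²)` with `s ≠ 0` even and `t` odd (`F` elliptic): Ogg's formula on the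
`ℤ₂`-exit model of §2. [cite: SilvermanATAEC1994, IV.9.4 and IV.11.1] -/
theorem conductorExponent_two_freyTwistCurve {s t : ℤ} (hs : Even s) (hs0 : s ≠ 0) (ht : Odd t)
    [(freyTwistCurve s t).IsElliptic] :
    (freyTwistCurve s t).conductorExponent ((Rat.HeightOneSpectrum.primesEquiv (R := ℤ)).symm ⟨2, Nat.prime_two⟩) = 4 := by
  haveI : Fact (Nat.Prime 2) := ⟨Nat.prime_two⟩
  -- `|s| = 2^{k'+1} m₀`, `m₀` odd
  obtain ⟨k, m₀, hm₀, hsk⟩ := Nat.exists_eq_two_pow_mul_odd (Int.natAbs_ne_zero.mpr hs0)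
  obtain ⟨k', rfl⟩ : ∃ k', k = k' + 1 := by
    rcases k with _ | k'
    · exfalso
      have : Even s.natAbs := Int.natAbs_even.mpr hs
      rw [hsk, pow_zero, one_mul] at this
      exact (Nat.not_even_iff_odd.mpr hm₀) this
    · exact ⟨k', rfl⟩
  obtain ⟨hexit, hord⟩ := freyTwist_exitModel k' hm₀ hsk ht
  set F := freyTwistCurve s t with hF
  set E : WeierstrassCurve ℤ_[2] := ⟨0, -(2 * (s : ℤ_[2]) ^ 2 + (t : ℤ_[2]) ^ 2), 0, 2 * (s : ℤ_[2]) ^ 2 * (t : ℤ_[2]) ^ 2, 0⟩ with hE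
  set T' : WeierstrassCurve ℤ_[2] := (⟨1, 0, 1, 0⟩ : VariableChange ℤ_[2]) • E with hT'
  have c2 : ((2 : ℤ_[2]) : ℚ_[2]) = 2 := map_ofNat PadicInt.Coe.ringHom 2
  have hEV : E.map (algebraMap ℤ_[2] ℚ_[2]) = F.baseChange ℚ_[2] := by
    rw [hF, hE]
    ext <;> simp [WeierstrassCurve.map, freyTwistCurve, c2]
  have h : T'.map (algebraMap ℤ_[2] ℚ_[2]) =
      ((⟨1, 0, 1, 0⟩ : VariableChange ℤ_[2]).map (algebraMap ℤ_[2] ℚ_[2])) • F.baseChange ℚ_[2] := by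
    rw [hT', ← hEV]
    exact (WeierstrassCurve.map_variableChange _ _ _).symm
  rw [conductorExponent_two_of_exitModel F T' _ h (by rw [hexit]; intro h'; cases h'), hexit, hord]
  simp only [KodairaSymbol.numComponents]
  omega

/-- **E-es-186♭ `FreyTwistShapeConductorExponentTwoLaw` HOLDS**: every elliptic `W/ℚ` that is `ℚ`-isomorphic to `y² = x(x − 2s²)(x − t²)` with `s` even
and `t` odd has `(N_W).factorization 2 = 4` — by `conductorExponent_two_freyTwistCurve`, the isomorphism invariance of `f₂` (`conductorExponent_smul'`) and
`factorization_conductorNorm_holds`.  UNCONDITIONAL local algebra. [cite: SilvermanATAEC1994, IV.9.4 and IV.11.1] -/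
theorem freyTwistShapeConductorExponentTwoLaw_holds : FreyTwistShapeConductorExponentTwoLaw := by
  intro W _ hshape
  haveI : Fact (Nat.Prime 2) := ⟨Nat.prime_two⟩
  obtain ⟨s, t, C, hs, ht, hCW⟩ := hshape
  set v : IsDedekindDomain.HeightOneSpectrum ℤ := (Rat.HeightOneSpectrum.primesEquiv (R := ℤ)).symm ⟨2, Nat.prime_two⟩ with hvdef
  have hv : Rat.HeightOneSpectrum.natGenerator v = 2 :=
    congrArg Subtype.val ((Rat.HeightOneSpectrum.primesEquiv (R := ℤ)).apply_symm_apply ⟨2, Nat.prime_two⟩)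
  haveI hF : (freyTwistCurve s t).IsElliptic := by rw [← hCW]; infer_instance
  -- `s ≠ 0`: otherwise the model is singular
  have hs0 : s ≠ 0 := by
    rintro rfl
    have hΔ := (freyTwistCurve 0 t).isUnit_Δ
    rw [freyTwistCurve_Δ] at hΔ
    simp at hΔ
  have hf : W.conductorExponent v = 4 := by
    rw [← WeierstrassCurve.conductorExponent_smul' v W C, hCW]
    exact conductorExponent_two_freyTwistCurve hs hs0 ht
  have hfac : (W.conductorNorm ℤ).factorization 2 = W.conductorExponent v := by
    rw [← hv]; exact W.factorization_conductorNorm_holds v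
  rw [hfac, hf]

/-- **E-es-186 `FreyTwistShapeTwoAdicLaw` modulo modularity** (`exists_isNewformOf`, level = conductor): es's proved glue
`freyTwistShapeTwoAdicLaw_of_local` with E-es-186♭ discharged. [cite: SilvermanATAEC1994, IV.9.4 and IV.11.1] [cite: DiamondShurman2005, Thm. 8.8.3] -/
theorem freyTwistShapeTwoAdicLaw_holds_of_modularity (hnf : exists_isNewformOf) : FreyTwistShapeTwoAdicLaw :=
  freyTwistShapeTwoAdicLaw_of_local freyTwistShapeConductorExponentTwoLaw_holds hnf

/-! ## §4 Compositions: E-an-152b ⟸ modularity ∧ E-es-185, and C2 ⟸ CDT THEOREM 1 ∧ E-es-185 -/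

/-- **E-an-152b `ShimuraIndexNeFourAtFour` ⟸ modularity ∧ E-es-185** (es's `shimuraIndexNeFourAtFour_of_shape_local` with E-es-186♭ discharged):
the index-`4` world is empty modulo the printed Modularity Theorem and the OPEN row E-es-185.  CONDITIONAL. [cite: Stevens1989, §2] -/
theorem shimuraIndexNeFourAtFour_of_modularity_shape185 (hnf : exists_isNewformOf) (h185 : IndexFourForcesFreyTwistShape) :
    ShimuraKernel.ShimuraIndexNeFourAtFour :=
  shimuraIndexNeFourAtFour_of_shape_local hnf h185 freyTwistShapeConductorExponentTwoLaw_holds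

/-- **C2 `ManinOddAtFour` (stmt-BirchSwinnertonDyer-22967) ⟸ CDT THEOREM 1 ∧ E-es-185.**  The crux's fourth binder IS `exists_isNewformOf`, so
modularity is not an extra hypothesis: E-es-185 + E-es-186♭ (§3) give E-an-152b, hence E-an-152c, and the integer `c`-division chain
(`CDivisionInt.maninOddAtFour_of_CDTInt_of_indexNeFourOddSquarefree`) closes C2 modulo CDT Theorem 1.  CONDITIONAL on the printed CDT Theorem 1
(statement-only) and the OPEN row E-es-185 (paper theorem, es §59.5; Lean needs the Galois action on `X₁(N)`-cusps); C2, Manin's conjecture and BSD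
are not proved by this. [cite: CalegariDimitrovTang2025, Thm. 1.0.1] [cite: Stevens1989, §2] [cite: LingOesterle1991, Thm. 6] -/
theorem maninOddAtFour_of_CDTInt_shape185 (hCDT : CalegariDimitrovTang2025_unboundedDenominators) (h185 : IndexFourForcesFreyTwistShape) :
    Summit.BirchSwinnertonDyer.BirchSwinnertonDyer.Theses.ManinLocalTwoThree.ManinOddAtFour := by
  intro hM hAU hC hnf
  exact CDivisionInt.maninOddAtFour_of_CDTInt_of_indexNeFourOddSquarefree hCDT
    (CDivisionNeron.shimuraIndexNeFourAtFourOddSquarefree_of_indexNeFour (shimuraIndexNeFourAtFour_of_modularity_shape185 hnf h185))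
    hM hAU hC hnf

/-- **THE WHOLE ROUTE: `ManinConstantOne` ⟸ PrintedSemistableManinFacts ∧ CDT Theorem 1 ∧ E-es-185** (the printed facts' fourth conjunct is modularity;
through the route's `closes` with C3 and C5 from the integer `c`-division chain).  CONDITIONAL architecture; MANIN'S CONJECTURE AND BSD ARE NOT PROVED BY
THIS. [cite: CalegariDimitrovTang2025, Thm. 1.0.1] [cite: Cesnavicius2018, Thm. 1.2] [cite: Stevens1989, §2] -/
theorem maninConstantOne_of_printedFacts_CDTInt_shape185
    (hPF : Summit.BirchSwinnertonDyer.BirchSwinnertonDyer.Theses.ManinLocalTwoThree.PrintedSemistableManinFacts)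
    (hCDT : CalegariDimitrovTang2025_unboundedDenominators) (h185 : IndexFourForcesFreyTwistShape) :
    Summit.BirchSwinnertonDyer.Rank1Residual.ManinConstant.ManinConstantOne :=
  Summit.BirchSwinnertonDyer.BirchSwinnertonDyer.Theses.ManinLocalTwoThree.closes hPF
    (maninOddAtFour_of_CDTInt_shape185 hCDT h185)
    (CDivisionInt.maninPrimeToThreeAtNine_of_CDTInt hCDT)
    (CDivisionInt.maninPrimeToAdditiveFiveLe_of_CDTInt hCDT)
    maninLocalTwoThree_assembly_proof

end Summit.BirchSwinnertonDyer.BirchSwinnertonDyer.Theorems.ManinLocalTwoThree.FreyTwistConductor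

end
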